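import Summits.HubbardSuperconductivity.HubbardSuperconductivity.Theses.DeformationLadder
import Literature.MathematicalPhysics.QuantumLattice.PairCorrelations

/-!
# Vocabulary of the inheritance cut for the crux `LowEnergyRigidity` (route `DeformationLadder`)

Crux item stmt-HubbardSuperconductivity-1892, decl
`Summit.HubbardSuperconductivity.HubbardSuperconductivity.Theses.DeformationLadder.LowEnergyRigidity`
(`S⁺`: for some `U > 0`, `δ ∈ (0,1/2)`, `κ > 0`, `a > 0` and all large even `L`, EVERY unit vector
`φ` of the sector `K_L = szSector N_L 0`, `N_L = 2⌊(1-δ)L²/2⌋`, with `Re⟨φ, H_L φ⟩ ≤ minEnergyOn H_L K_L + κ`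
has `d`-wave LRO density `L⁻⁴ Re⟨φ, Δ_dᴴΔ_d φ⟩ ≥ a`; `H_L = hubbardTorus 2 L 1 U`,
`Δ_d = pairField dWaveFormFactor L`).

This file only NAMES the objects of the crux idea `condensation-gap-inheritance` (crux-ideate round 1,
`Cruxes/LowEnergyRigidity/Ideas/condensation-gap-inheritance.md`), over which the companion module
`DeformationLadderLowEnergyRigidityInheritance` proves the cut
`CondensationGapAt U δ → MesoRigidityAt U δ → LowEnergyRigidity`:

* `blockPair L R x = Σ_{a ∈ [0,R)²} P_{x+a}` — the `d`-wave local pairs `P_y = localPair dWaveFormFactor L y`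
  summed over the `R × R` block based at the torus site `x` (the block wraps around the torus when
  `R > L`; every statement below uses `R` fixed and `L → ∞`);
* `mesoOp L R = Σ_x (blockPair L R x)ᴴ * blockPair L R x` — the MESOSCOPIC pair-order operator (an
  extensive sum of local positive terms; `mesoOp L R / (L² R⁴)` is the block-averaged `d`-wave pair
  order density, and `mesoOp L R ≥ (R⁴/L²)·Δ_dᴴΔ_d` by the variance identity proved in the companion);
* `CondensationGapAt U δ` — (A) of the card at the point `(U, δ)`: mesoscopically UNPAIRED sector
  states (`⟨mesoOp L R⟩_φ/(L²R⁴) ≤ θ`) cost EXTENSIVE energy `≥ ε L²` above the sector ground energy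
  (`θ` uniform in `R ≥ R₀`, `ε = ε(R) > 0`);
* `MesoRigidityAt U δ` — (B) of the card at the point `(U, δ)`: block pair weight at NONZERO momenta
  (`⟨mesoOp⟩/(L²R⁴) − L⁻⁴⟨Δ_dᴴΔ_d⟩`) in excess of a slack `σ` costs TOTAL energy at a rate `γ(R) > 0`
  once `R ≥ R₁(σ)`. The card states (B) for ALL `U > 0`, `δ ∈ (0,1/2)`; the cut only needs it at the
  witness `(U, δ)` of (A), which is the (weaker) form named here.

Nothing is proved here. Sources: the idea card (ideator 1, 2026-08-16); Lieb–Seiringer–Yngvason,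
*The Mathematics of the Bose Gas and its Condensation* (2005) Thm 6.2 and §7 (energy components of
approximate minimisers — the inheritance lever); Scalapino, Phys. Rep. 250 (1995) 329 §2 (pair
operators); Fejér-kernel positivity [folklore].
-/

noncomputable section

namespace Summit.HubbardSuperconductivity.HubbardSuperconductivity.Theorems.LowEnergyRigidity

set_option linter.dupNamespace false -- summit = problem name (single-conjunct summit), D-0017

open Matrix
open scoped ComplexOrder
open Literature.MathematicalPhysics.QuantumLattice Literature.Probability.LatticeModels
open Summit.HubbardSuperconductivity.HubbardSuperconductivity.Theses.DeformationLadder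

/-- The block pair operator `B_R(x) = Σ_{a ∈ [0,R)²} P_{x+a}`: the `d`-wave local singlet pairs
`P_y = localPair dWaveFormFactor L y` summed over the `R × R` block of torus sites based at `x`
(offsets `a = (a₀, a₁)`, `0 ≤ aᵢ < R`, projected to `(ℤ/Lℤ)²` by `Torus.proj`).
(Idea card condensation-gap-inheritance, `blockPair`.) [folklore] -/
def blockPair (L : ℕ) [NeZero L] (R : ℕ) (x : TorusSite 2 L) :
    Matrix (Finset (Orb (FermionTorus 2 L))) (Finset (Orb (FermionTorus 2 L))) ℂ :=
  ∑ a : Fin R × Fin R,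
    localPair dWaveFormFactor L (x + Torus.proj L ![((a.1 : ℕ) : ℤ), ((a.2 : ℕ) : ℤ)])

/-- The mesoscopic `d`-wave pair-order operator `𝓜_R = Σ_x B_R(x)ᴴ B_R(x)` (sum over all block
positions `x` of the torus; positive semidefinite, and `𝓜_R ≥ (R⁴/L²)·Δ_dᴴΔ_d`).
(Idea card condensation-gap-inheritance, `mesoOp`.) [folklore] -/
def mesoOp (L : ℕ) [NeZero L] (R : ℕ) :
    Matrix (Finset (Orb (FermionTorus 2 L))) (Finset (Orb (FermionTorus 2 L))) ℂ :=
  ∑ x : TorusSite 2 L, (blockPair L R x)ᴴ * blockPair L R x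

/-- **(A) Condensation gap at `(U, δ)`** (card `condensation-gap-inheritance`, stub `CondensationGap`,
specialised to one point): there are `θ > 0` and `R₀` such that for every block size `R ≥ R₀` some
`ε > 0` makes, for all large even `L`, every unit vector `φ` of the sector
`szSector (2⌊(1-δ)L²/2⌋) 0` with block pair order `Re⟨φ, 𝓜_R φ⟩/(L²R⁴) ≤ θ` pay extensive energy:
`minEnergyOn H_L K_L + ε L² ≤ Re⟨φ, H_L φ⟩`. (The condensation energy as a constrained variational
gap; a thermodynamic statement.) Route-posited HYPOTHESIS of the cut (idea card
condensation-gap-inheritance, stub (A)); conjecture-grade, never asserted. -/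
def CondensationGapAt (U δ : ℝ) : Prop :=
  ∃ θ : ℝ, 0 < θ ∧ ∃ R₀ : ℕ, ∀ R : ℕ, R₀ ≤ R → ∃ ε : ℝ, 0 < ε ∧ ∃ L₀ : ℕ, ∀ (L : ℕ) [NeZero L],
    L₀ ≤ L → Even L →
    ∀ φ : Fock (Orb (FermionTorus 2 L)),
      φ ∈ szSector (Λ := FermionTorus 2 L) (2 * ⌊(1 - δ) * (L : ℝ) ^ 2 / 2⌋₊) 0 →
      star φ ⬝ᵥ φ = 1 →
      (expect (mesoOp L R) φ).re / ((L : ℝ) ^ 2 * (R : ℝ) ^ 4) ≤ θ →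
      (hubbardTorus 2 L 1 U).minEnergyOn
          (szSector (Λ := FermionTorus 2 L) (2 * ⌊(1 - δ) * (L : ℝ) ^ 2 / 2⌋₊) 0) + ε * (L : ℝ) ^ 2 ≤
        (star φ ⬝ᵥ Matrix.mulVec (hubbardTorus 2 L 1 U) φ).re

/-- **(B) Mesoscopic rigidity at `(U, δ)`** (card `condensation-gap-inheritance`, stub `MesoRigidity`,
specialised to one point): for every slack `σ > 0` there is `R₁` such that for every `R ≥ R₁` some
rate `γ > 0` makes, for all large even `L` and every unit sector vector `φ`,
`γ · (Re⟨φ, 𝓜_R φ⟩/(L²R⁴) − Re⟨φ, Δ_dᴴΔ_d φ⟩/L⁴ − σ) ≤ Re⟨φ, H_L φ⟩ − minEnergyOn H_L K_L`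
(block pair weight at nonzero momenta beyond the slack costs total energy linearly). The card files
this for all `U > 0`, `δ ∈ (0,1/2)`; the cut uses it only at the witness of (A).
Route-posited HYPOTHESIS of the cut (idea card condensation-gap-inheritance, stub (B));
conjecture-grade, never asserted. -/
def MesoRigidityAt (U δ : ℝ) : Prop :=
  ∀ σ : ℝ, 0 < σ → ∃ R₁ : ℕ, ∀ R : ℕ, R₁ ≤ R → ∃ γ : ℝ, 0 < γ ∧ ∃ L₀ : ℕ, ∀ (L : ℕ) [NeZero L],
    L₀ ≤ L → Even L →
    ∀ φ : Fock (Orb (FermionTorus 2 L)),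
      φ ∈ szSector (Λ := FermionTorus 2 L) (2 * ⌊(1 - δ) * (L : ℝ) ^ 2 / 2⌋₊) 0 →
      star φ ⬝ᵥ φ = 1 →
      γ * ((expect (mesoOp L R) φ).re / ((L : ℝ) ^ 2 * (R : ℝ) ^ 4) -
          (expect ((pairField dWaveFormFactor L)ᴴ * pairField dWaveFormFactor L) φ).re / (L : ℝ) ^ 4 -
          σ) ≤
        (star φ ⬝ᵥ Matrix.mulVec (hubbardTorus 2 L 1 U) φ).re -
          (hubbardTorus 2 L 1 U).minEnergyOn
            (szSector (Λ := FermionTorus 2 L) (2 * ⌊(1 - δ) * (L : ℝ) ^ 2 / 2⌋₊) 0)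

end Summit.HubbardSuperconductivity.HubbardSuperconductivity.Theorems.LowEnergyRigidity
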